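import Mathlib
import Literature.NumberTheory.LFunctions.Zhang2022.SkeletonPartThree
import Literature.NumberTheory.LFunctions.Zhang2022.TypedAppendixB
import Literature.NumberTheory.LFunctions.Zhang2022.SkeletonAlpha1
import Literature.NumberTheory.LFunctions.Zhang2022.AppendixBLemma151Circles
import Literature.NumberTheory.LFunctions.Zhang2022.AppendixBLemma151LineShiftRect
import Literature.NumberTheory.LFunctions.Zhang2022.AppendixBLemma151LineShiftBounds
import Literature.Analysis.Complex.VerticalLineShift

/-!
# Zhang (2022) Appendix B, proof of Lemma 15.1, `μ = 2`: the contour shift — the line `Re s = 1`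
# of `ζ(1+s)/ζ(1+s−β_j)·(P₂/l₁)ˢ/((log P₂)(s−β₇)²)` equals the residues at `0`, `β₇` up to `O(α₁)`

Topic `Literature/NumberTheory/LFunctions/Zhang2022` (Landau–Siegel audit tree; verdict-neutral).
Y. Zhang, *Discrete mean estimates and the Landau–Siegel zero*, arXiv:2211.02515v1 (2022)
[Zhang2022LandauSiegel] — **an unrefereed manuscript under adjudication; nothing in this file
asserts any claim of the manuscript beyond the displayed step it PROVES.** ZHANG-L discharge lane
(WP15, App. B block B1 under the leaf `Typed.Section15C.Eq15_22`, Lemma 15.1 χ-reading), DAG node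
`Z22:§B.u009` (text after the display) [Z22 p.107, tex L5298]: "In a way similar to the proof of
Lemma 8.1, we see that the right side is equal to the sum of the residues of the integrand at `s = 0`
and `s = β₇` plus an acceptable error", typed in the reading of record (`α₁ = α log T`) as
`Typed.AppendixB.StepB_u009rR`.

PROVED here: `stepB_u009rR_holds : StepB_u009rR c′` — for `D` large, `j ∈ {1,2,3}`, `1 ≤ l₁ < T`,
`‖(1/2πi)∫_{(1)} intB2 − (2πi)⁻¹∮_{|s|=5α} intB2‖ ≤ C·α₁` (in fact `O(1/log P₂) = O(𝓛⁻⁹)`).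
Contour: with `y = P₂/l₁` (`log y ≥ 𝓛⁹/8`) and `ε = 1/log y`, the line `Re s = 1` is moved to
`Re s = ε` (no singularities in between; `Literature.Analysis.Complex.integral_vertical_eq_of_differentiableOn`
with the integrability/decay of `AppendixBLemma151LineShiftBounds`); the segment `|t| ≤ t₀` of that
line is the right side of the box `[−t₀, ε] × [−t₀, t₀]`, whose boundary integral is
`∮_{|s|=5α} intB2` (`AppendixBLemma151LineShiftRect.intB2_rect_eq_circle_of_le`); the three other
sides are `O(1/log P₂)` (the integrand is `G(s)/(s(s−β₇)²)` with `|G| ≤ 3|s−β_j|·e/log P₂` there,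
`ζ₁` being controlled on the small box by `AppendixBLemma151Cauchy.zeta1_near_one`), and the two
tails `|t| ≥ t₀` of the line `Re s = ε` are `O(1/log P₂)` by the majorant
`(C/log P₂)·y^ε·(1+|t|)^{−3/2}`, `y^ε = e` (`norm_intB2_le_majorant`, from Titchmarsh's Theorem 3.5
and (3.6.5) in the tree). Finally `1/log P₂ ≤ 4/𝓛⁹ = (4/π)α ≤ (4/π)α₁`. The box size `t₀` is an
absolute constant (from `zeta1_near_one` and the rectangle lemma); every constant is explicit in
`t₀`, the compact bound `M` for `1/ζ`, and `∫(1+|t|)^{−3/2}dt`.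

With `stepB_u011bR_holds` (`AppendixBLemma151ResBetaValue`) this completes the inputs of
`AppendixBLemma151Residues.stepB_mu2_alpha1_of`: the `μ = 2` case of Lemma 15.1 in the `α₁`
reading (`stepB_mu2R_holds` below).

WHAT THIS IS NOT: the cases `μ = 1, 3`, Lemma 15.1 itself, or any claim about Theorems 1–2 /
Landau–Siegel zeros.

## References

* Y. Zhang, arXiv:2211.02515v1 (2022), App. B p. 107. [cite: Zhang2022LandauSiegel, App. B p.107]
* E. C. Titchmarsh, *The Theory of the Riemann Zeta-Function* (1986), §3.5–3.6. [Titchmarsh1986]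
-/

noncomputable section

open Complex Real Metric Set Filter Topology MeasureTheory

namespace Literature.NumberTheory.LFunctions.Zhang2022.Skeleton

open Typed.AppendixB (zetaRatio kerB intB2 vline vkSum)
open Literature.Analysis.Complex (rectBoundaryIntegral rectBoundaryIntegral_def
  integral_vertical_eq_of_differentiableOn)

section LineShift

variable (c' : ℝ)

/-- `L₀ ≤ log D` once `D ≥ ⌈exp L₀⌉₊`. [folklore] -/
private theorem le_ell_of_ceil_exp_le₅ {L₀ : ℝ} {D : ℕ} (hD : ⌈Real.exp L₀⌉₊ ≤ D) : L₀ ≤ ell D := by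
  have h : Real.exp L₀ ≤ D := le_trans (Nat.le_ceil _) (by exact_mod_cast hD)
  exact (Real.le_log_iff_exp_le (lt_of_lt_of_le (Real.exp_pos _) h)).mpr h

/-- The bookkeeping of the contour: line = tails + middle, middle = rectangle − other sides, so
`(1/2π)(T₁ + mid + T₂) − (2πi)⁻¹(bot − top + i·mid − i·left) = (1/2π)(T₁ + T₂ + left) − (2πi)⁻¹(bot − top)`.
[folklore] -/
private theorem contour_bookkeeping (T₁ T₂ mid left top bot : ℂ) :
    (1 / (2 * Real.pi) : ℂ) * (T₁ + mid + T₂) - (2 * π * I)⁻¹ * (bot - top + I * mid - I * left) =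
      (1 / (2 * Real.pi) : ℂ) * (T₁ + T₂ + left) - (2 * π * I)⁻¹ * (bot - top) := by
  have hπ : (π : ℂ) ≠ 0 := by exact_mod_cast Real.pi_ne_zero
  field_simp
  ring

/-- **The integrand on the box via its holomorphic numerator**: at a point `s ≠ 0, β_j` where
`|ζ₁(1+s)| ≤ 3/2`, `|ζ₁(1+s−β_j)⁻¹| ≤ 2` and `(P₂/l₁)^{Re s} ≤ E`,
`‖intB2(s)‖ ≤ 3‖s−β_j‖E/((log P₂)‖s‖‖s−β₇‖²)`. [cite: Zhang2022LandauSiegel, App. B p.107] -/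
theorem norm_intB2_le_of_G (D j l₁ : ℕ) {s : ℂ} (hs0 : s ≠ 0) (hsb : s ≠ betaJ c' D j)
    (hsβ : s ≠ beta7 D) (hL : 0 < Real.log (P2 D)) (hx : 0 < P2 D / l₁)
    (hz1 : ‖riemannZeta₁ (1 + s)‖ ≤ 3 / 2) (hz0 : riemannZeta₁ (1 + s - betaJ c' D j) ≠ 0)
    (hz2 : ‖(riemannZeta₁ (1 + s - betaJ c' D j))⁻¹‖ ≤ 2) {E : ℝ} (hE : (P2 D / l₁) ^ s.re ≤ E) :
    ‖intB2 c' D j l₁ s‖ ≤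
      3 * ‖s - betaJ c' D j‖ * E / (Real.log (P2 D) * (‖s‖ * ‖s - beta7 D‖ ^ 2)) := by
  have hLc : (Real.log (P2 D) : ℂ) ≠ 0 := by exact_mod_cast hL.ne'
  rw [intB2_eq_G_div c' D j l₁ hs0 hsb hz0 hLc, norm_div, norm_div, norm_mul, norm_mul, norm_mul,
    norm_mul, norm_pow, Complex.norm_cpow_eq_rpow_re_of_pos hx, Complex.norm_real,
    Real.norm_eq_abs, abs_of_pos hL]
  have hden : 0 < ‖s‖ * ‖s - beta7 D‖ ^ 2 :=
    mul_pos (norm_pos_iff.mpr hs0) (pow_pos (norm_pos_iff.mpr (sub_ne_zero.mpr hsβ)) 2)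
  rw [div_div, div_le_div_iff₀ (by positivity) (by positivity)]
  have hE0 : 0 ≤ E := le_trans (Real.rpow_nonneg hx.le _) hE
  have hnum : ‖riemannZeta₁ (1 + s)‖ * ‖s - betaJ c' D j‖ * ‖(riemannZeta₁ (1 + s - betaJ c' D j))⁻¹‖ *
      (P2 D / l₁) ^ s.re ≤ 3 / 2 * ‖s - betaJ c' D j‖ * 2 * E := by
    gcongr
  calc ‖riemannZeta₁ (1 + s)‖ * ‖s - betaJ c' D j‖ * ‖(riemannZeta₁ (1 + s - betaJ c' D j))⁻¹‖ *
        (P2 D / l₁) ^ s.re * (Real.log (P2 D) * (‖s‖ * ‖s - beta7 D‖ ^ 2))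
      ≤ (3 / 2 * ‖s - betaJ c' D j‖ * 2 * E) * (Real.log (P2 D) * (‖s‖ * ‖s - beta7 D‖ ^ 2)) :=
        mul_le_mul_of_nonneg_right hnum (by positivity)
    _ = 3 * ‖s - betaJ c' D j‖ * E * (Real.log (P2 D) * (‖s‖ * ‖s - beta7 D‖ ^ 2)) := by ring

/-- **`StepB_u009rR` holds** (Z22:§B.u009, the contour shift of the `μ = 2` case, in the `α₁`
reading of record): for `D` large, `j ∈ {1,2,3}`, `1 ≤ l₁ < T`,
`‖vline 1 (intB2 c′ D j l₁) − (2πi)⁻¹∮_{|s|=5α} intB2‖ ≤ C·α₁`. See the module docstring.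
[cite: Zhang2022LandauSiegel, App. B p.107] -/
theorem stepB_u009rR_holds : Typed.AppendixB.StepB_u009rR c' := by
  obtain ⟨δ, hδ, K, hK, hζ⟩ := zeta1_near_one
  obtain ⟨δ₀, hδ₀, hrect⟩ := intB2_rect_eq_circle_of_le c'
  -- the box size `t₀`
  set t₀ : ℝ := min (min (δ / 4) δ₀) (min (1 / (8 * K + 8)) 1) with ht₀def
  have ht₀0 : 0 < t₀ := by
    rw [ht₀def]
    refine lt_min (lt_min (by positivity) hδ₀) (lt_min (by positivity) one_pos)
  have ht₀δ : t₀ ≤ δ / 4 := le_trans (min_le_left _ _) (min_le_left _ _)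
  have ht₀δ₀ : t₀ ≤ δ₀ := le_trans (min_le_left _ _) (min_le_right _ _)
  have ht₀K : t₀ ≤ 1 / (8 * K + 8) := le_trans (min_le_right _ _) (min_le_left _ _)
  have ht₀1 : t₀ ≤ 1 := le_trans (min_le_right _ _) (min_le_right _ _)
  have hKt₀ : 4 * K * t₀ ≤ 1 / 2 := by
    have h8 : 0 < 8 * K + 8 := by positivity
    have : 4 * K * t₀ ≤ 4 * K * (1 / (8 * K + 8)) := mul_le_mul_of_nonneg_left ht₀K (by positivity)
    have h2 : 4 * K * (1 / (8 * K + 8)) ≤ 1 / 2 := by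
      rw [mul_one_div, div_le_iff₀ h8]; linarith
    linarith
  obtain ⟨Drect, hrect'⟩ := hrect t₀ ht₀0 ht₀δ₀
  obtain ⟨M, hM0, hM⟩ := exists_norm_inv_riemannZeta_le_near (t₀ := t₀ / 2) (by positivity)
  -- absolute constants
  set K₇ : ℝ := 1134 * 16 * 336 ^ 4 with hK₇
  set Cmaj : ℝ := 256 * 16 ^ 8 * K₇ + 36 * (196 * M / t₀ ^ 3) with hCmaj
  have hCmaj0 : 0 ≤ Cmaj := by rw [hCmaj, hK₇]; positivity
  set J : ℝ := ∫ t : ℝ, (1 + |t|) ^ (-(3 / 2 : ℝ)) with hJdef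
  have hJ0 : 0 ≤ J := integral_nonneg fun t => Real.rpow_nonneg (by positivity) _
  set Ctot : ℝ := (1 / (2 * π)) * (2 * (Cmaj * Real.exp 1 * J) + 18 / t₀ + 2 * (72 * Real.exp 1 / t₀))
    with hCtot
  have hCtot0 : 0 ≤ Ctot := by rw [hCtot]; positivity
  refine ⟨Ctot * (4 / π),
    max Drect (max 8 ⌈Real.exp (max (max (max 2 (60 * |c'| * π)) (max (10 * π / t₀) (8 * K * π)))
      (8 / t₀))⌉₊),
    fun D _ χ hD hq hp j hj l₁ hl₁ _ hT => ?_⟩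
  have hDrect : Drect ≤ D := le_trans (le_max_left _ _) hD
  have hℓbig := le_ell_of_ceil_exp_le₅ (le_trans (le_max_right _ _) (le_trans (le_max_right _ _) hD))
  have hℓA : max (max 2 (60 * |c'| * π)) (max (10 * π / t₀) (8 * K * π)) ≤ ell D :=
    le_trans (le_max_left _ _) hℓbig
  have hℓB : 8 / t₀ ≤ ell D := le_trans (le_max_right _ _) hℓbig
  obtain ⟨hℓ2, hc, hδα, -, hα0, -, hLlow⟩ := large_package c' ht₀0 hK hℓA
  obtain ⟨-, hb4, hb2, hb7, hn7⟩ := betaJ_size c' hℓ2 hc hj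
  obtain ⟨tb, htb, -⟩ := Typed.AppendixB.betaJ_bound c' D j hα0.le (by linarith only [hℓ2])
  -- notation
  set ℓ : ℝ := ell D with hℓdef
  set a : ℝ := alpha D with hadef
  set b : ℂ := betaJ c' D j with hbdef
  set β : ℂ := beta7 D with hβdef
  set L : ℝ := Real.log (P2 D) with hLdef
  set F : ℂ → ℂ := intB2 c' D j l₁ with hFdef
  have hℓ0 : 0 < ℓ := by linarith only [hℓ2]
  have hℓ1 : 1 ≤ ℓ := by linarith only [hℓ2]
  have h9 : a * ℓ ^ 9 = π := by
    rw [hadef, alpha, bigP, Real.log_exp, ← hℓdef, div_mul_cancel₀ _ (pow_ne_zero _ hℓ0.ne')]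
  have hL0 : 0 < L := lt_of_lt_of_le (by positivity) hLlow
  have hbre : b.re = 0 := by rw [htb]; simp
  have hβ7 : β = (((5 * a / 2 : ℝ)) : ℂ) * I := by rw [hβdef, beta7, ← hadef]; push_cast; ring
  have hβre : β.re = 0 := by rw [hβ7]; simp
  have hαt : 5 * a ≤ t₀ := by linarith only [hδα, hα0]
  have hbt : ‖b‖ ≤ t₀ / 2 := by linarith only [hb4, hδα, hα0]
  -- `y = P₂/l₁ > 1`, `log y ≥ ℓ⁹/8`
  have hl₁0 : (0 : ℝ) < l₁ := by exact_mod_cast hl₁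
  have hP2 : 0 < P2 D := by
    rw [P2]; exact div_pos (Real.rpow_pos_of_pos (Real.exp_pos _) _) (pow_pos (Real.exp_pos _) _)
  have hLeq : L = ℓ ^ 9 / 2 - 10 * ℓ ^ (1.1 : ℝ) := by rw [hLdef, log_P2]
  have h11 : ℓ ^ (1.1 : ℝ) ≤ ℓ ^ 2 := by
    calc ℓ ^ (1.1 : ℝ) ≤ ℓ ^ (2 : ℝ) := Real.rpow_le_rpow_of_exponent_le hℓ1 (by norm_num)
      _ = ℓ ^ 2 := by norm_cast
  have hℓ7 : (128 : ℝ) ≤ ℓ ^ 7 := le_trans (by norm_num) (pow_le_pow_left₀ (by norm_num) hℓ2 7)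
  have h128 : 128 * ℓ ^ 2 ≤ ℓ ^ 9 := by
    have h := mul_le_mul_of_nonneg_left hℓ7 (pow_pos hℓ0 2).le
    have e : ℓ ^ 2 * ℓ ^ 7 = ℓ ^ 9 := by ring
    linarith only [h, e]
  have hlogl₁ : Real.log l₁ ≤ ℓ ^ (1.1 : ℝ) := by
    have h := Real.log_le_log hl₁0 hT.le
    rwa [bigT, Real.log_exp] at h
  have hlogl₁0 : 0 ≤ Real.log l₁ := Real.log_nonneg (by exact_mod_cast hl₁)
  set y : ℝ := P2 D / l₁ with hydef
  have hy0 : 0 < y := div_pos hP2 hl₁0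
  have hlogy : Real.log y = L - Real.log l₁ := by rw [hydef, Real.log_div hP2.ne' hl₁0.ne', hLdef]
  have hlogy_ge : ℓ ^ 9 / 8 ≤ Real.log y := by
    rw [hlogy, hLeq]; linarith only [h11, h128, hlogl₁, pow_nonneg hℓ0.le 9]
  have hℓ9 : ℓ ≤ ℓ ^ 9 := le_self_pow₀ hℓ1 (by norm_num)
  have hlogy_pos : 0 < Real.log y := lt_of_lt_of_le (by positivity) hlogy_ge
  have hy1 : 1 ≤ y := by
    have : 0 ≤ Real.log y := hlogy_pos.le
    rwa [Real.log_nonneg_iff hy0] at this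
  -- `ε = 1/log y`
  set ε : ℝ := 1 / Real.log y with hεdef
  have hε0 : 0 < ε := by positivity
  have hεt : ε ≤ t₀ := by
    rw [hεdef, div_le_iff₀ hlogy_pos]
    have h1 : 8 ≤ t₀ * ℓ := by
      have := mul_le_mul_of_nonneg_left hℓB ht₀0.le
      rwa [mul_div_cancel₀ _ ht₀0.ne'] at this
    have h2 : t₀ * ℓ ≤ t₀ * ℓ ^ 9 := mul_le_mul_of_nonneg_left hℓ9 ht₀0.le
    nlinarith only [h1, h2, hlogy_ge, ht₀0]
  have hε1 : ε ≤ 1 := le_trans hεt ht₀1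
  have hyε : y ^ ε = Real.exp 1 := by
    rw [Real.rpow_def_of_pos hy0, hεdef, mul_one_div_cancel hlogy_pos.ne']
  -- `ζ₁` on the box: `|z| ≤ 4t₀ ⇒ |ζ₁(1+z)| ≤ 3/2`, `|ζ₁(1+z)⁻¹| ≤ 2`
  have hzeta : ∀ z : ℂ, ‖z‖ ≤ 4 * t₀ →
      ‖riemannZeta₁ (1 + z)‖ ≤ 3 / 2 ∧ riemannZeta₁ (1 + z) ≠ 0 ∧ ‖(riemannZeta₁ (1 + z))⁻¹‖ ≤ 2 := by
    intro z hz
    have hzδ : ‖z‖ ≤ δ := by linarith only [hz, ht₀δ]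
    obtain ⟨h1, -, h3⟩ := hζ z hzδ
    have hsmall : ‖riemannZeta₁ (1 + z) - 1‖ ≤ 1 / 2 := by
      calc ‖riemannZeta₁ (1 + z) - 1‖ ≤ K * ‖z‖ := h1
        _ ≤ K * (4 * t₀) := mul_le_mul_of_nonneg_left hz hK
        _ ≤ 1 / 2 := by linarith only [hKt₀]
    have hup : ‖riemannZeta₁ (1 + z)‖ ≤ 3 / 2 := by
      calc ‖riemannZeta₁ (1 + z)‖ = ‖(riemannZeta₁ (1 + z) - 1) + 1‖ := by ring_nf
        _ ≤ ‖riemannZeta₁ (1 + z) - 1‖ + ‖(1 : ℂ)‖ := norm_add_le _ _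
        _ ≤ 3 / 2 := by rw [norm_one]; linarith only [hsmall]
    have hlow : 1 / 2 ≤ ‖riemannZeta₁ (1 + z)‖ := by
      have := norm_sub_norm_le (1 : ℂ) (riemannZeta₁ (1 + z))
      rw [norm_one, norm_sub_rev] at this
      linarith only [this, hsmall]
    refine ⟨hup, h3, ?_⟩
    rw [norm_inv, inv_le_comm₀ (by linarith only [hlow]) two_pos]
    linarith only [hlow]
  -- integrability on the two lines, decay, differentiability
  have hint : ∀ σ : ℝ, 0 < σ → σ ≤ 1 → Integrable fun t : ℝ => F (σ + t * I) := fun σ hσ0 hσ1 =>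
    integrable_intB2_line c' D j l₁ ht₀0 ht₀1 hM0 hM hbt hbre hβ7 hα0 hαt hL0 hy0 hσ0 hσ1
  have hdecay := intB2_horizontal_decay c' D j l₁ ht₀0 ht₀1 hM0 hM hbt hbre hβ7 hα0 hαt hL0 hy1 hε0
  have hdiff : DifferentiableOn ℂ F (re ⁻¹' Icc ε 1) := fun s hs =>
    (differentiableAt_intB2 c' D j l₁ hL0.ne' hy0 hbre hβre
      (lt_of_lt_of_le hε0 hs.1)).differentiableWithinAt
  -- the shift `Re s = 1 → Re s = ε`
  have hshift : ∫ t : ℝ, F (((1 : ℝ) : ℂ) + t * I) = ∫ t : ℝ, F ((ε : ℂ) + t * I) :=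
    (integral_vertical_eq_of_differentiableOn hε1 hdiff (hint ε hε0 hε1) (hint 1 one_pos le_rfl)
      hdecay).symm
  have hvline : vline 1 F = (1 / (2 * Real.pi) : ℂ) * ∫ t : ℝ, F ((ε : ℂ) + t * I) := by
    rw [vline, hshift]
  -- split the line `Re s = ε`
  have hintε := hint ε hε0 hε1
  set T₁ : ℂ := ∫ t in Iic (-t₀), F ((ε : ℂ) + t * I) with hT₁
  set T₂ : ℂ := ∫ t in Ioi t₀, F ((ε : ℂ) + t * I) with hT₂
  set mid : ℂ := ∫ t in (-t₀)..t₀, F ((ε : ℂ) + t * I) with hmid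
  have hsplit : ∫ t : ℝ, F ((ε : ℂ) + t * I) = T₁ + mid + T₂ := by
    have h1 : (∫ t in Iic t₀, F ((ε : ℂ) + t * I)) + T₂ = ∫ t : ℝ, F ((ε : ℂ) + t * I) :=
      intervalIntegral.integral_Iic_add_Ioi hintε.integrableOn hintε.integrableOn
    have h2 : ∫ t in Iic t₀, F ((ε : ℂ) + t * I) =
        T₁ + ∫ t in Ioc (-t₀) t₀, F ((ε : ℂ) + t * I) := by
      rw [hT₁, ← setIntegral_union (Iic_disjoint_Ioc le_rfl) measurableSet_Ioc hintε.integrableOn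
        hintε.integrableOn, Iic_union_Ioc_eq_Iic (by linarith only [ht₀0])]
    have h3 : ∫ t in Ioc (-t₀) t₀, F ((ε : ℂ) + t * I) = mid := by
      rw [hmid, intervalIntegral.integral_of_le (by linarith only [ht₀0])]
    rw [← h1, h2, h3]
  -- the rectangle
  have hR := hrect' D hDrect j hj l₁ hl₁ ε hε0 hεt
  rw [rectBoundaryIntegral_def] at hR
  set left : ℂ := ∫ t in (-t₀)..t₀, F (((-t₀ : ℝ) : ℂ) + t * I) with hleft
  set top : ℂ := ∫ x in (-t₀)..ε, F ((x : ℂ) + ((t₀ : ℝ) : ℂ) * I) with htop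
  set bot : ℂ := ∫ x in (-t₀)..ε, F ((x : ℂ) + ((-t₀ : ℝ) : ℂ) * I) with hbot
  have hcirc : (∮ s in C((0 : ℂ), 5 * a), F s) = bot - top + I * mid - I * left := by
    rw [← hR]
  -- the identity to estimate
  have hkey : vline 1 F - (2 * π * I)⁻¹ * (∮ s in C((0 : ℂ), 5 * a), F s) =
      (1 / (2 * Real.pi) : ℂ) * (T₁ + T₂ + left) - (2 * π * I)⁻¹ * (bot - top) := by
    rw [hvline, hsplit, hcirc, contour_bookkeeping]
  -- BOUNDS. (1) the tails
  set g : ℝ → ℝ := fun t => Cmaj / L * Real.exp 1 * (1 + |t|) ^ (-(3 / 2 : ℝ)) with hgdef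
  have hgint : Integrable g := integrable_one_add_abs_rpow.const_mul _
  have hg0 : ∀ t, 0 ≤ g t := fun t => by rw [hgdef]; positivity
  have hmaj : ∀ t : ℝ, t₀ ≤ |t| → ‖F ((ε : ℂ) + t * I)‖ ≤ g t := by
    intro t ht
    have h := norm_intB2_le_majorant c' D j l₁ ht₀0 ht₀1 hM0 hM hbt hbre hβ7 hα0 hαt hL0 hy0
      hε0 hε1 ht
    rw [hgdef]; simp only []
    rw [← hydef, hyε, ← hLdef, ← hK₇, ← hCmaj] at h
    exact h
  have hJg : ∫ t, g t = Cmaj / L * Real.exp 1 * J := by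
    rw [hgdef, hJdef, ← integral_const_mul]
  have htail : ∀ S : Set ℝ, MeasurableSet S → (∀ t ∈ S, t₀ ≤ |t|) →
      ‖∫ t in S, F ((ε : ℂ) + t * I)‖ ≤ Cmaj / L * Real.exp 1 * J := by
    intro S hS hSt
    calc ‖∫ t in S, F ((ε : ℂ) + t * I)‖ ≤ ∫ t in S, g t :=
          norm_integral_le_of_norm_le hgint.integrableOn
            (ae_restrict_of_forall_mem hS fun t ht => hmaj t (hSt t ht))
      _ ≤ ∫ t, g t := setIntegral_le_integral hgint (Eventually.of_forall hg0)
      _ = Cmaj / L * Real.exp 1 * J := hJg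
  have hT₁b : ‖T₁‖ ≤ Cmaj / L * Real.exp 1 * J :=
    htail _ measurableSet_Iic fun t ht => by
      have : t ≤ -t₀ := ht
      rw [abs_of_neg (by linarith only [this, ht₀0])]; linarith only [this]
  have hT₂b : ‖T₂‖ ≤ Cmaj / L * Real.exp 1 * J :=
    htail _ measurableSet_Ioi fun t ht => by
      have : t₀ < t := ht
      rw [abs_of_pos (by linarith only [this, ht₀0])]; linarith only [this]
  -- (2) the left side `Re s = −t₀`
  have hleftb : ‖left‖ ≤ 9 / (L * t₀ ^ 2) * |t₀ - -t₀| := by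
    refine intervalIntegral.norm_integral_le_of_norm_le_const fun t ht => ?_
    rw [uIoc_of_le (by linarith only [ht₀0])] at ht
    have ht' : |t| ≤ t₀ := abs_le.mpr ⟨ht.1.le, ht.2⟩
    set s : ℂ := ((-t₀ : ℝ) : ℂ) + t * I with hsdef
    have hsre : s.re = -t₀ := by simp [hsdef]
    have hsim : s.im = t := by simp [hsdef]
    have hns : ‖s‖ ≤ 2 * t₀ := by
      calc ‖s‖ ≤ |s.re| + |s.im| := Complex.norm_le_abs_re_add_abs_im s
        _ ≤ t₀ + t₀ := by rw [hsre, hsim, abs_neg, abs_of_pos ht₀0]; linarith only [ht']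
        _ = 2 * t₀ := by ring
    have hns' : t₀ ≤ ‖s‖ := by
      have := Complex.abs_re_le_norm s; rw [hsre, abs_neg, abs_of_pos ht₀0] at this; exact this
    have hs0 : s ≠ 0 := by intro h; rw [h, norm_zero] at hns'; linarith only [hns', ht₀0]
    have hsb : s ≠ b := by
      intro h; have := congrArg Complex.re h; rw [hsre, hbre] at this; linarith only [this, ht₀0]
    have hsβn : t₀ ≤ ‖s - β‖ := by
      have := Complex.abs_re_le_norm (s - β)
      rw [Complex.sub_re, hsre, hβre, sub_zero, abs_neg, abs_of_pos ht₀0] at this; exact this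
    have hsβ : s ≠ β := by intro h; rw [h, sub_self, norm_zero] at hsβn; linarith only [hsβn, ht₀0]
    have hnsb : ‖s - b‖ ≤ 3 * t₀ := by
      calc ‖s - b‖ ≤ ‖s‖ + ‖b‖ := norm_sub_le _ _
        _ ≤ 3 * t₀ := by linarith only [hns, hbt, ht₀0]
    obtain ⟨hz1, -, -⟩ := hzeta s (by linarith only [hns, ht₀0])
    obtain ⟨-, hz0, hz2⟩ := hzeta (s - b) (by linarith only [hnsb, ht₀0])
    rw [show (1 : ℂ) + (s - b) = 1 + s - b by ring] at hz0 hz2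
    have hE : (P2 D / l₁) ^ s.re ≤ 1 := by
      rw [hsre]; exact Real.rpow_le_one_of_one_le_of_nonpos hy1 (by linarith only [ht₀0])
    have h := norm_intB2_le_of_G c' D j l₁ hs0 hsb hsβ hL0 hy0 hz1 hz0 hz2 hE
    refine h.trans ?_
    have hden : 0 < L * (‖s‖ * ‖s - β‖ ^ 2) :=
      mul_pos hL0 (mul_pos (lt_of_lt_of_le ht₀0 hns')
        (pow_pos (lt_of_lt_of_le ht₀0 hsβn) 2))
    rw [div_le_div_iff₀ hden (by positivity)]
    have h1 : ‖s‖ * ‖s - β‖ ^ 2 ≥ t₀ * t₀ ^ 2 := by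
      have := pow_le_pow_left₀ ht₀0.le hsβn 2
      exact mul_le_mul hns' this (by positivity) (norm_nonneg _)
    calc 3 * ‖s - b‖ * 1 * (L * t₀ ^ 2) ≤ 3 * (3 * t₀) * 1 * (L * t₀ ^ 2) := by gcongr
      _ = 9 * (L * (t₀ * t₀ ^ 2)) := by ring
      _ ≤ 9 * (L * (‖s‖ * ‖s - β‖ ^ 2)) := by gcongr
  have hleftb' : ‖left‖ ≤ 18 / (L * t₀) := by
    refine hleftb.trans (le_of_eq ?_)
    rw [show t₀ - -t₀ = 2 * t₀ by ring, abs_of_pos (by positivity)]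
    field_simp
    ring
  -- (3) the horizontal sides `Im s = ±t₀`
  have hhoriz : ∀ (τ : ℝ), |τ| = t₀ →
      ‖∫ x in (-t₀)..ε, F ((x : ℂ) + (τ : ℂ) * I)‖ ≤ 36 * Real.exp 1 / (L * t₀ ^ 2) * |ε - -t₀| := by
    intro τ hτ
    refine intervalIntegral.norm_integral_le_of_norm_le_const fun x hx => ?_
    rw [uIoc_of_le (by linarith only [ht₀0, hε0])] at hx
    have hx' : |x| ≤ t₀ := abs_le.mpr ⟨hx.1.le, hx.2.trans hεt⟩
    set s : ℂ := (x : ℂ) + (τ : ℂ) * I with hsdef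
    have hsre : s.re = x := by simp [hsdef]
    have hsim : s.im = τ := by simp [hsdef]
    have hns : ‖s‖ ≤ 2 * t₀ := by
      calc ‖s‖ ≤ |s.re| + |s.im| := Complex.norm_le_abs_re_add_abs_im s
        _ ≤ t₀ + t₀ := by rw [hsre, hsim, hτ]; linarith only [hx']
        _ = 2 * t₀ := by ring
    have hns' : t₀ ≤ ‖s‖ := by
      have := Complex.abs_im_le_norm s; rw [hsim, hτ] at this; exact this
    have hs0 : s ≠ 0 := by intro h; rw [h, norm_zero] at hns'; linarith only [hns', ht₀0]
    have hbim : |b.im| < t₀ := by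
      have := Complex.abs_im_le_norm b; linarith only [this, hbt, ht₀0]
    have hsb : s ≠ b := by
      intro h; have := congrArg Complex.im h; rw [hsim] at this
      rw [← this, hτ] at hbim; exact lt_irrefl _ hbim
    have hβim : β.im = 5 * a / 2 := by rw [hβ7]; simp
    have hsβn : t₀ / 2 ≤ ‖s - β‖ := by
      have him := Complex.abs_im_le_norm (s - β)
      rw [Complex.sub_im, hsim, hβim] at him
      have h2 : t₀ - 5 * a / 2 ≤ |τ - 5 * a / 2| := by
        have h3 := abs_sub_abs_le_abs_sub τ (5 * a / 2)
        rw [hτ, abs_of_pos (by positivity : (0:ℝ) < 5 * a / 2)] at h3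
        linarith only [h3]
      linarith only [him, h2, hαt]
    have hsβ : s ≠ β := by
      intro h; rw [h, sub_self, norm_zero] at hsβn; linarith only [hsβn, ht₀0]
    have hnsb : ‖s - b‖ ≤ 3 * t₀ := by
      calc ‖s - b‖ ≤ ‖s‖ + ‖b‖ := norm_sub_le _ _
        _ ≤ 3 * t₀ := by linarith only [hns, hbt, ht₀0]
    obtain ⟨hz1, -, -⟩ := hzeta s (by linarith only [hns, ht₀0])
    obtain ⟨-, hz0, hz2⟩ := hzeta (s - b) (by linarith only [hnsb, ht₀0])
    rw [show (1 : ℂ) + (s - b) = 1 + s - b by ring] at hz0 hz2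
    have hE : (P2 D / l₁) ^ s.re ≤ Real.exp 1 := by
      rw [hsre, ← hyε]
      exact Real.rpow_le_rpow_of_exponent_le hy1 hx.2
    have h := norm_intB2_le_of_G c' D j l₁ hs0 hsb hsβ hL0 hy0 hz1 hz0 hz2 hE
    refine h.trans ?_
    have hden : 0 < L * (‖s‖ * ‖s - β‖ ^ 2) :=
      mul_pos hL0 (mul_pos (lt_of_lt_of_le ht₀0 hns')
        (pow_pos (lt_of_lt_of_le (by positivity) hsβn) 2))
    rw [div_le_div_iff₀ hden (by positivity)]
    have hprod : t₀ * (t₀ / 2) ^ 2 ≤ ‖s‖ * ‖s - β‖ ^ 2 := by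
      have := pow_le_pow_left₀ (by positivity) hsβn 2
      exact mul_le_mul hns' this (by positivity) (norm_nonneg _)
    have he0 : 0 < Real.exp 1 := Real.exp_pos 1
    calc 3 * ‖s - b‖ * Real.exp 1 * (L * t₀ ^ 2)
        ≤ 3 * (3 * t₀) * Real.exp 1 * (L * t₀ ^ 2) := by gcongr
      _ = 36 * Real.exp 1 * (L * (t₀ * (t₀ / 2) ^ 2)) := by ring
      _ ≤ 36 * Real.exp 1 * (L * (‖s‖ * ‖s - β‖ ^ 2)) := by gcongr
  have hhoriz' : ∀ (τ : ℝ), |τ| = t₀ →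
      ‖∫ x in (-t₀)..ε, F ((x : ℂ) + (τ : ℂ) * I)‖ ≤ 72 * Real.exp 1 / (L * t₀) := by
    intro τ hτ
    refine (hhoriz τ hτ).trans ?_
    have hlen : |ε - -t₀| ≤ 2 * t₀ := by
      rw [abs_of_pos (by linarith only [hε0, ht₀0])]; linarith only [hεt]
    calc 36 * Real.exp 1 / (L * t₀ ^ 2) * |ε - -t₀| ≤ 36 * Real.exp 1 / (L * t₀ ^ 2) * (2 * t₀) := by
          gcongr
      _ = 72 * Real.exp 1 / (L * t₀) := by field_simp; ring
  have htopb : ‖top‖ ≤ 72 * Real.exp 1 / (L * t₀) :=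
    hhoriz' t₀ (abs_of_pos ht₀0)
  have hbotb : ‖bot‖ ≤ 72 * Real.exp 1 / (L * t₀) :=
    hhoriz' (-t₀) (by rw [abs_neg, abs_of_pos ht₀0])
  -- assemble
  have hn1 : ‖(1 / (2 * Real.pi) : ℂ)‖ = 1 / (2 * π) := by
    rw [norm_div, norm_one, norm_mul, Complex.norm_real, Real.norm_eq_abs,
      abs_of_pos Real.pi_pos, Complex.norm_two]
  have hn2 : ‖(2 * π * I : ℂ)⁻¹‖ = 1 / (2 * π) := by
    rw [norm_inv, norm_mul, norm_mul, Complex.norm_I, mul_one, Complex.norm_real,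
      Real.norm_eq_abs, abs_of_pos Real.pi_pos, Complex.norm_two, one_div]
  have hα1 : alpha1 D = a * ℓ ^ (1.1 : ℝ) := by rw [alpha1, log_bigT]
  have h1l : (1 : ℝ) ≤ ℓ ^ (1.1 : ℝ) := Real.one_le_rpow hℓ1 (by norm_num)
  have hLinv : 1 / L ≤ 4 / π * (a * ℓ ^ (1.1 : ℝ)) := by
    rw [div_le_iff₀ hL0]
    have h4 : 1 ≤ 4 / π * a * L := by
      have := mul_le_mul_of_nonneg_left hLlow (by positivity : (0:ℝ) ≤ 4 / π * a)
      have e : 4 / π * a * (ℓ ^ 9 / 4) = 1 := by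
        rw [← h9]; field_simp
      linarith only [this, e]
    have h5 : 4 / π * a * L ≤ 4 / π * (a * ℓ ^ (1.1 : ℝ)) * L := by
      have : a ≤ a * ℓ ^ (1.1 : ℝ) := by
        have := mul_le_mul_of_nonneg_left h1l hα0.le; simpa using this
      have hπ4 : (0:ℝ) ≤ 4 / π := by positivity
      nlinarith only [this, hπ4, hL0.le, mul_le_mul_of_nonneg_left this hπ4]
    linarith only [h4, h5]
  rw [hkey]
  calc ‖(1 / (2 * Real.pi) : ℂ) * (T₁ + T₂ + left) - (2 * π * I)⁻¹ * (bot - top)‖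
      ≤ ‖(1 / (2 * Real.pi) : ℂ) * (T₁ + T₂ + left)‖ + ‖(2 * π * I)⁻¹ * (bot - top)‖ :=
        norm_sub_le _ _
    _ ≤ 1 / (2 * π) * (‖T₁‖ + ‖T₂‖ + ‖left‖) + 1 / (2 * π) * (‖bot‖ + ‖top‖) := by
        rw [norm_mul, norm_mul, hn1, hn2]
        gcongr
        · exact (norm_add_le _ _).trans (add_le_add (norm_add_le _ _) le_rfl)
        · exact norm_sub_le _ _
    _ ≤ 1 / (2 * π) * (Cmaj / L * Real.exp 1 * J + Cmaj / L * Real.exp 1 * J + 18 / (L * t₀)) +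
          1 / (2 * π) * (72 * Real.exp 1 / (L * t₀) + 72 * Real.exp 1 / (L * t₀)) := by
        gcongr
    _ = Ctot * (1 / L) := by rw [hCtot]; field_simp; ring
    _ ≤ Ctot * (4 / π * (a * ℓ ^ (1.1 : ℝ))) := mul_le_mul_of_nonneg_left hLinv hCtot0
    _ = Ctot * (4 / π) * alpha1 D := by rw [hα1]; ring

/-- `StepB_u009rR` — `_holds` alias of `stepB_u009rR_holds` above under the fact's exact name (appended
2026-08-28, D-0026 bookkeeping: the proof term is the existing theorem of this file; no statement,
definition or attribute is edited; no new named fact; the ledger's debt table listed the fact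
unproved). [cite: Zhang2022LandauSiegel, App. B p.107] -/
theorem _root_.Literature.NumberTheory.LFunctions.Zhang2022.Typed.AppendixB.StepB_u009rR_holds :
    Typed.AppendixB.StepB_u009rR c' :=
  _root_.Literature.NumberTheory.LFunctions.Zhang2022.Skeleton.stepB_u009rR_holds (c' := c')

end LineShift

end Literature.NumberTheory.LFunctions.Zhang2022.Skeleton
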